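import Summits.AtomisticToContinuum.HydrodynamicLimit.Theorems.AntiMazurCoboundariesCorrectorPressureDecayTransfer
import Summits.AtomisticToContinuum.HydrodynamicLimit.Theorems.CorrectorPressureDecay.Negative.DiscreteWindowOfKineticFlux
import Summits.AtomisticToContinuum.HydrodynamicLimit.Theorems.AntiMazurCoboundariesPressureCertificateTransfer
import Summits.AtomisticToContinuum.HydrodynamicLimit.Theses.FluxGibbsianityLdDrude

/-!
# `CorrectorPressureDecay`: the by-name equivalences `X ↔ 10967 ↔ DWPD ↔ FSD`

Route `AntiMazurCoboundaries` of `AtomisticToContinuum/HydrodynamicLimit`, crux stmt-AtomisticToContinuum-14135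
(`CorrectorPressureDecay`, "X"), line `kinetic-entropy-collision-budget` (lead c1). Helper file (`--supports`): what X is
EQUIVALENT to, as tree theorems concluding route decls BY NAME (positive halves from
`AntiMazurCoboundariesCorrectorPressureDecayTransfer.lean`, negative-side halves from the refuters' landed
`Negative/DiscreteWindowOfCorrector.lean`, `Negative/DiscreteWindowOfKineticFlux.lean` and the glue
`pressureCertificateTransfer_proof`, stmt-14139).

* `correctorPressureDecay_of_kineticFluxLdDecay : KineticFluxLdDecay → CorrectorPressureDecay` (converse of stmt-14139);
  `correctorPressureDecay_iff_kineticFluxLdDecay : CorrectorPressureDecay ↔ KineticFluxLdDecay` — cruxes stmt-14135 and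
  stmt-10967 are ONE statement; primed version against the byte-identical copy `FluxGibbsianityLdDrude.KineticFluxLdDecay`
  (the route in which stmt-10967 is led).
* `correctorPressureDecay_iff_discreteWindowPressureDecay` — the corrector/lag freedom of X buys nothing over the
  discrete-window statistics.
* `fastSectorDominance_iff_correctorPressureDecay` — the line's open stub in the planner's quantifier order is a costume
  of X (the refuters' verdict as an `iff`); only the RATE form `FastSectorDominanceRate` is strictly stronger.

References: Kipnis–Landim (1999) Ch. 7; Olla–Varadhan–Yau, CMP 155 (1993) §3.
-/

noncomputable section

open MeasureTheory ProbabilityTheory InformationTheory Set Filter Topology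
open scoped ENNReal

namespace Summit.AtomisticToContinuum.HydrodynamicLimit.Theorems.CorrectorPressureDecayEquivalences

open Summit.AtomisticToContinuum.HydrodynamicLimit.Theses.AntiMazurCoboundaries
  (CorrectorPressureDecay KineticFluxLdDecay)
open Summit.AtomisticToContinuum.HydrodynamicLimit.Theorems.CorrectorPressureDecayNegative.FastSectorSandwich
  (FastSectorDominance FastSectorDominanceRate DiscreteWindowPressureDecay)
open Summit.AtomisticToContinuum.HydrodynamicLimit.Theorems.CorrectorPressureDecayNegative.DiscreteWindow
  (fastSectorDominance_of_correctorPressureDecay' discreteWindowPressureDecay_of_correctorPressureDecay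
    discreteWindowPressureDecay_of_kineticFluxLdDecay)
open Summit.AtomisticToContinuum.HydrodynamicLimit.Theorems.CorrectorPressureDecayTransfer
  (correctorPressureDecay_of_fastSectorDominance correctorPressureDecay_of_discreteWindowPressureDecay)

/-- **The shared wall implies the crux**: `KineticFluxLdDecay → CorrectorPressureDecay` (converse of the landed glue
stmt-14139), by `discreteWindowPressureDecay_of_kineticFluxLdDecay` and the previous theorem. -/
theorem correctorPressureDecay_of_kineticFluxLdDecay (h : KineticFluxLdDecay) : CorrectorPressureDecay :=
  correctorPressureDecay_of_discreteWindowPressureDecay (discreteWindowPressureDecay_of_kineticFluxLdDecay h)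

/-- **Cruxes stmt-14135 and stmt-10967 are one statement**: `CorrectorPressureDecay ↔ KineticFluxLdDecay`
(`⇒` = `pressureCertificateTransfer_proof`, the exponential anti-Mazur certificate; `⇐` = the discrete Fejér corrector
fed by discrete-window pressure decay). -/
theorem correctorPressureDecay_iff_kineticFluxLdDecay : CorrectorPressureDecay ↔ KineticFluxLdDecay :=
  ⟨Summit.AtomisticToContinuum.HydrodynamicLimit.Theorems.pressureCertificateTransfer_proof,
    correctorPressureDecay_of_kineticFluxLdDecay⟩

/-- The same equivalence against the copy of the wall filed in route `FluxGibbsianityLdDrude` (where stmt-10967 is led):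
the two route decls have byte-identical bodies. -/
theorem correctorPressureDecay_iff_kineticFluxLdDecay' :
    CorrectorPressureDecay ↔
      Summit.AtomisticToContinuum.HydrodynamicLimit.Theses.FluxGibbsianityLdDrude.KineticFluxLdDecay :=
  correctorPressureDecay_iff_kineticFluxLdDecay

/-- **The crux is exactly discrete-window pressure decay** of fast one-body observables: the corrector and lag
freedom of X buys nothing over the window statistics. -/
theorem correctorPressureDecay_iff_discreteWindowPressureDecay :
    CorrectorPressureDecay ↔ DiscreteWindowPressureDecay :=
  ⟨discreteWindowPressureDecay_of_correctorPressureDecay, correctorPressureDecay_of_discreteWindowPressureDecay⟩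

/-- **The costume as a theorem**: the line's open stub in the planner's quantifier order is EQUIVALENT to the crux
(`⇒` the composition above; `⇐` the refuters' unconditional `fastSectorDominance_of_correctorPressureDecay'`). -/
theorem fastSectorDominance_iff_correctorPressureDecay : FastSectorDominance ↔ CorrectorPressureDecay :=
  ⟨correctorPressureDecay_of_fastSectorDominance, fastSectorDominance_of_correctorPressureDecay'⟩

/-- Registered form `kecb_cruxIffWall` (stub of crux stmt-AtomisticToContinuum-14135, line `kinetic-entropy-collision-budget`):
the crux and the shared wall stmt-10967 are one statement. -/
theorem kecb_cruxIffWall : CorrectorPressureDecay ↔ KineticFluxLdDecay :=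
  correctorPressureDecay_iff_kineticFluxLdDecay

end Summit.AtomisticToContinuum.HydrodynamicLimit.Theorems.CorrectorPressureDecayEquivalences

end
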